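import Summits.AnomalousDissipation.AnomalousDissipation.Theorems.EnsembleRigidityGPMeanBoundedFamilyStubSymmetricLimit
import Summits.AnomalousDissipation.AnomalousDissipation.Theorems.BaireTransferRobustLoudUpgradeStubDriftClassicalOfWeak
import Literature.Analysis.FluidPDE.SteadyNavierStokesProofs
import Literature.Analysis.FluidPDE.SteadyNavierStokesRegularity

/-!
# Crux `LightSteadyStatesGP` (stmt-AnomalousDissipation-15151, route VirtualDissipation), line `Sketch`:
  stub `stub_symmSteadyStateGP` (S2) — symmetric Galerkin approximations ⇒ a `G`-symmetric
  mean-zero classical steady state of `NS_ν(f_GP)` at every `ν > 0`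

Given, at a fixed `ν > 0`, smooth divergence-free mean-zero `G`-symmetric Galerkin approximations
`U N` on the punctured frequency balls `S_N` with Temam's a priori bounds (the hypothesis, stub S1
verbatim), the proof is the tree's passage to the limit (Temam 1979, Ch. II §1, Thm. 1.2 (iii), as
in `Torus.exists_mem_energySpaceV_isSteadyWeakSolution`): the enstrophy ball is compact in `H`
(Rellich, `Torus.isCompact_setOf_eGradNormSq_le`), a subsequence converges strongly in `L²` to
`u ∈ V`, which is a steady weak solution (`Torus.tendsto_integral_weakForm_of_tendsto_lintegral`,
`Torus.tendsto_integral_weakForm_fourierTruncate`). Strong convergence gives weak convergence of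
the pairings, so the covariance of the approximants under the three generators of `G`
(coordinate 3-cycle, inversion, twisted half-turn — all volume preserving) passes to the limit
a.e. (`StubSymmetricLimit.ae_symm_of_tendsto`). Temam's regularity theorem
(`Torus.Temam1979_steadyWeakSolution_smooth_holds`, Ch. II Prop. 1.1) gives a smooth
representative `v`; two continuous functions equal a.e. for the Haar measure are equal
(`Continuous.ae_eq_iff_eq`), so `v` is `G`-symmetric at every point; the pressure is the
Helmholtz potential of the smooth residual (`DriftClassical.exists_pressure`), and
constant-in-time smooth data are classical solutions on `univ × T³` (`isSmoothSpaceTimeOn_const`,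
`timeDerivWithin univ (const) = 0`).

References: Temam 1979, Ch. II §1, Thm. 1.2 and Prop. 1.1; Robinson–Rodrigo–Sadowski 2016,
Thm. 4.4 Step 4.
-/

noncomputable section

-- every `Summit.AnomalousDissipation.AnomalousDissipation.…` name repeats the summit = sub-problem
-- segment (D-0017 layout)
set_option linter.dupNamespace false

namespace Summit.AnomalousDissipation.AnomalousDissipation.Theorems.VirtualDissipation.LightSteadyStatesGP

open MeasureTheory Filter Topology UnitAddTorus
open scoped InnerProductSpace ENNReal
open Literature.Analysis.FunctionSpaces Literature.Analysis.FluidPDE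
open Summit.AnomalousDissipation.AnomalousDissipation.Theorems.EnsembleRigidity

namespace StubSymmSteadyState

-- adapted from Literature/Analysis/FluidPDE/SteadyNavierStokesProofs.lean
-- (`Torus.exists_mem_energySpaceV_isSteadyWeakSolution`, the Galerkin sequence taken as a
-- hypothesis, the weak `L²` convergence of the subsequence added to the conclusion)
/-- **The limit of a stationary Galerkin sequence** (Temam 1979, Ch. II §1, Thm. 1.2, proof
(iii); Robinson–Rodrigo–Sadowski 2016, Thm. 4.4 Step 4). Let `f ∈ L²(T³; ℝ³)` and let smooth
divergence-free mean-zero fields `U N` with `‖∇U N‖² ≤ R < ∞`, `∫ ‖U N‖² ≤ L < ∞` solve the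
tested Galerkin equations `∫ (⟪U N, (U N·∇)a⟫ + ν ⟪U N, Δa⟫ + ⟪f, a⟫) = 0` against every
smooth divergence-free `a` band-limited to the punctured ball `S_N`. Then along a subsequence
`φ` the `U (φ j)` converge weakly in `L²` (indeed strongly: the enstrophy ball is compact in
`H`, `Torus.isCompact_setOf_eGradNormSq_le`) to some `u ∈ V` which is a steady weak solution of
`NS_ν(f)` (`Torus.tendsto_integral_weakForm_of_tendsto_lintegral`,
`Torus.tendsto_integral_weakForm_fourierTruncate`, `Torus.integral_weakForm_eq`).
[cite: Temam1979, Ch. II Thm. 1.2 (proof (iii))] -/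
theorem exists_limit {ν : ℝ} {f : UnitAddTorus (Fin 3) → EuclideanSpace ℝ (Fin 3)}
    (hf : MemLp f 2 volume) {R L : ℝ≥0∞} (hR : R ≠ ∞) (hL : L ≠ ∞)
    {U : ℕ → UnitAddTorus (Fin 3) → EuclideanSpace ℝ (Fin 3)} (hUs : ∀ N, Torus.IsSmooth (U N))
    (hUdiv : ∀ N, Torus.IsDivFree (U N)) (hUmean : ∀ N, Torus.HasZeroMean (U N))
    (hUgrad : ∀ N, Torus.eGradNormSq (U N) ≤ R) (hUL2 : ∀ N, ∫⁻ x, ‖U N x‖ₑ ^ 2 ≤ L)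
    (hUtest : ∀ N (a : UnitAddTorus (Fin 3) → EuclideanSpace ℝ (Fin 3)), Torus.IsSmooth a →
      Torus.IsDivFree a →
      (∀ k ∉ (Torus.freqBall (d := Fin 3) N).erase 0,
        mFourierCoeff (EuclideanSpace.complexify ∘ a) k = 0) →
      ∫ x, (⟪U N x, Torus.convect (U N) a x⟫_ℝ + ν * ⟪U N x, Torus.laplacian a x⟫_ℝ +
        ⟪f x, a x⟫_ℝ) = 0) :
    ∃ (u : Torus.energySpace (Fin 3)) (φ : ℕ → ℕ), StrictMono φ ∧
      u.1 ∈ Torus.energySpaceV (Fin 3) ∧ Torus.IsSteadyWeakSolution ν f u ∧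
      ∀ a : UnitAddTorus (Fin 3) → EuclideanSpace ℝ (Fin 3), MemLp a 2 volume →
        Tendsto (fun j => ∫ y, ⟪U (φ j) y, a y⟫_ℝ) atTop
          (𝓝 (∫ y, ⟪(u.1 : UnitAddTorus (Fin 3) → EuclideanSpace ℝ (Fin 3)) y, a y⟫_ℝ)) := by
  have hUm : ∀ N, MemLp (U N) 2 volume := fun N => (hUs N).memLp 2
  -- the approximations as elements of `H`
  have hmem : ∀ N, (hUm N).toLp (U N) ∈ Torus.energySpace (Fin 3) := fun N =>
    Torus.smoothSolenoidal_subset_energySpace ⟨U N, hUs N, hUdiv N, hUmean N, (hUm N).coeFn_toLp⟩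
  set v : ℕ → Torus.energySpace (Fin 3) := fun N => ⟨(hUm N).toLp (U N), hmem N⟩ with hv
  have hvae : ∀ N, ((v N).1 : UnitAddTorus (Fin 3) → EuclideanSpace ℝ (Fin 3)) =ᵐ[volume] U N :=
    fun N => (hUm N).coeFn_toLp
  -- compactness of the enstrophy ball (Rellich)
  set K : Set (Torus.energySpace (Fin 3)) :=
    {u | Torus.eGradNormSq (u.1 : UnitAddTorus (Fin 3) → EuclideanSpace ℝ (Fin 3)) ≤ R} with hK
  have hKc : IsCompact K := Torus.isCompact_setOf_eGradNormSq_le hR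
  have hvK : ∀ N, v N ∈ K := fun N => by
    show Torus.eGradNormSq ((v N).1 : UnitAddTorus (Fin 3) → EuclideanSpace ℝ (Fin 3)) ≤ R
    rw [Torus.eGradNormSq_congr_ae_field (hvae N)]
    exact hUgrad N
  obtain ⟨u, huK, φ, hφ, hlim⟩ := hKc.tendsto_subseq hvK
  have huL2 : MemLp (u.1 : UnitAddTorus (Fin 3) → EuclideanSpace ℝ (Fin 3)) 2 volume := Lp.memLp _
  have huG : Torus.eGradNormSq (u.1 : UnitAddTorus (Fin 3) → EuclideanSpace ℝ (Fin 3)) ≤ R := huK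
  have h1 : Tendsto (fun j => (v (φ j)).1) atTop (𝓝 u.1) :=
    (continuous_subtype_val.tendsto u).comp hlim
  refine ⟨u, φ, hφ, ⟨u.2, Torus.memSobolev_one_complexify_of_eGradNormSq_ne_top huL2
    (ne_top_of_le_ne_top hR huG)⟩, ?_, ?_⟩
  · -- strong convergence in `L²` along the subsequence
    have hconv : Tendsto (fun j => ∫⁻ x,
        ‖U (φ j) x - (u.1 : UnitAddTorus (Fin 3) → EuclideanSpace ℝ (Fin 3)) x‖ₑ ^ 2)
        atTop (𝓝 0) := by
      have h2 := tendsto_iff_norm_sub_tendsto_zero.1 h1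
      have h3 : Tendsto (fun j => ‖(v (φ j)).1 - u.1‖ₑ ^ 2) atTop (𝓝 0) := by
        have h4 := ENNReal.tendsto_ofReal h2
        rw [ENNReal.ofReal_zero] at h4
        have h5 := ((ENNReal.continuous_pow 2).tendsto 0).comp h4
        rw [zero_pow two_ne_zero] at h5
        refine h5.congr fun j => ?_
        simp only [Function.comp_apply, ofReal_norm]
      refine h3.congr fun j => ?_
      rw [← Torus.lintegral_enorm_coe_sub_coe_sq]
      refine lintegral_congr_ae ?_
      filter_upwards [hvae (φ j)] with x hx
      rw [hx]
    -- the weak formulation: first against the truncations `P_M w`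
    intro w hw hwdiv hwmean
    have htrunc : ∀ M : ℕ, ∫ x, (⟪(u.1 : UnitAddTorus (Fin 3) → EuclideanSpace ℝ (Fin 3)) x,
        Torus.convect (u.1 : UnitAddTorus (Fin 3) → EuclideanSpace ℝ (Fin 3))
          (Torus.fourierTruncate M w) x⟫_ℝ +
        ν * ⟪(u.1 : UnitAddTorus (Fin 3) → EuclideanSpace ℝ (Fin 3)) x,
          Torus.laplacian (Torus.fourierTruncate M w) x⟫_ℝ +
        ⟪f x, Torus.fourierTruncate M w x⟫_ℝ) = 0 := by
      intro M
      have ha : Torus.IsSmooth (Torus.fourierTruncate M w) := Torus.isSmooth_fourierTruncate M w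
      have hadiv : Torus.IsDivFree (Torus.fourierTruncate M w) :=
        Torus.isDivFree_realTrigPoly (hwdiv.isTransversal_mFourierCoeff hw (Torus.freqBall M))
      have hw0 : mFourierCoeff (EuclideanSpace.complexify ∘ w) 0 = 0 := by
        rw [Torus.mFourierCoeff_eq_integral_volume]
        simp only [neg_zero, mFourier_zero, ContinuousMap.one_apply, one_smul,
          Function.comp_apply]
        rw [EuclideanSpace.complexify.integral_comp_comm w, hwmean, map_zero]
      have hband : ∀ N, M ≤ N → ∀ k ∉ (Torus.freqBall (d := Fin 3) N).erase 0,
          mFourierCoeff (EuclideanSpace.complexify ∘ Torus.fourierTruncate M w) k = 0 := by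
        intro N hMN k hk
        rw [Torus.mFourierCoeff_fourierTruncate hw.integrable]
        by_cases hkM : k ∈ Torus.freqBall M
        · have hk0 : k = 0 := by
            by_contra h
            exact hk (Finset.mem_erase.2 ⟨h, Torus.freqBall_mono hMN hkM⟩)
          subst hk0
          rw [if_pos hkM, hw0]
        · rw [if_neg hkM]
      have hev : ∀ᶠ j in atTop,
          ∫ x, (⟪U (φ j) x, Torus.convect (U (φ j)) (Torus.fourierTruncate M w) x⟫_ℝ +
            ν * ⟪U (φ j) x, Torus.laplacian (Torus.fourierTruncate M w) x⟫_ℝ +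
            ⟪f x, Torus.fourierTruncate M w x⟫_ℝ) = 0 := by
        filter_upwards [eventually_ge_atTop M] with j hj
        exact hUtest (φ j) _ ha hadiv (hband (φ j) (hj.trans (hφ.id_le j)))
      have hl := Torus.tendsto_integral_weakForm_of_tendsto_lintegral (ν := ν) hf
        (fun n => hUm (φ n)) huL2 hL (fun n => hUL2 (φ n)) hconv ha
      exact tendsto_nhds_unique hl (tendsto_const_nhds.congr' (hev.mono fun j hj => hj.symm))
    -- remove the truncation
    have hl2 := Torus.tendsto_integral_weakForm_fourierTruncate ν hf huL2 hw
    have hzero : ∫ x, (⟪(u.1 : UnitAddTorus (Fin 3) → EuclideanSpace ℝ (Fin 3)) x,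
        Torus.convect (u.1 : UnitAddTorus (Fin 3) → EuclideanSpace ℝ (Fin 3)) w x⟫_ℝ +
        ν * ⟪(u.1 : UnitAddTorus (Fin 3) → EuclideanSpace ℝ (Fin 3)) x, Torus.laplacian w x⟫_ℝ +
        ⟪f x, w x⟫_ℝ) = 0 :=
      tendsto_nhds_unique hl2 (tendsto_const_nhds.congr fun M => (htrunc M).symm)
    have hfinal : Torus.nsGeneratorPairing ν f u w =
        ∫ x, (⟪(u.1 : UnitAddTorus (Fin 3) → EuclideanSpace ℝ (Fin 3)) x,
          Torus.convect (u.1 : UnitAddTorus (Fin 3) → EuclideanSpace ℝ (Fin 3)) w x⟫_ℝ +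
          ν * ⟪(u.1 : UnitAddTorus (Fin 3) → EuclideanSpace ℝ (Fin 3)) x, Torus.laplacian w x⟫_ℝ +
          ⟪f x, w x⟫_ℝ) := by
      rw [Torus.integral_weakForm_eq ν hf huL2 hw]
      rfl
    rw [hfinal]
    exact hzero
  · -- weak convergence of the pairings (from the strong convergence in `H`)
    intro a ha
    have hpair : ∀ w : Lp (EuclideanSpace ℝ (Fin 3)) 2 (volume : Measure (UnitAddTorus (Fin 3))),
        ⟪w, ha.toLp a⟫_ℝ =
          ∫ y, ⟪(w : UnitAddTorus (Fin 3) → EuclideanSpace ℝ (Fin 3)) y, a y⟫_ℝ := fun w => by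
      rw [L2.inner_def]
      exact integral_congr_ae (by filter_upwards [ha.coeFn_toLp] with y hy; rw [hy])
    have h2 : Tendsto (fun j => ⟪(v (φ j)).1, ha.toLp a⟫_ℝ) atTop (𝓝 ⟪u.1, ha.toLp a⟫_ℝ) :=
      h1.inner tendsto_const_nhds
    rw [hpair] at h2
    refine h2.congr fun j => ?_
    rw [hpair]
    exact integral_congr_ae (by filter_upwards [hvae (φ j)] with y hy; rw [hy])

/-- The coordinate 3-cycle is continuous. [folklore] -/
theorem continuous_cycShift : Continuous cycShift :=
  continuous_pi fun j =>
    (continuous_apply (j + 1) : Continuous fun y : UnitAddTorus (Fin 3) => y (j + 1))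

/-- The twisted half-turn is continuous (coordinatewise translations and negations). [folklore] -/
theorem continuous_twistTurn : Continuous twistTurn := by
  refine continuous_pi fun i => ?_
  fin_cases i
  · show Continuous fun y : UnitAddTorus (Fin 3) => y 0 + halfPeriod
    fun_prop
  · show Continuous fun y : UnitAddTorus (Fin 3) => -(y 1)
    fun_prop
  · show Continuous fun y : UnitAddTorus (Fin 3) => -(y 2) + halfPeriod
    fun_prop

/-- **A.e. covariance of a continuous field is covariance**: if `(v (A y))ᵢ = c (v y)ⱼ` for a.e.
`y` with `v`, `A` continuous, then it holds at every `y` (two continuous functions equal a.e. for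
the Haar measure of `T³` are equal, `Continuous.ae_eq_iff_eq`). [folklore] -/
theorem symm_of_ae {A : UnitAddTorus (Fin 3) → UnitAddTorus (Fin 3)} (hA : Continuous A)
    {v : UnitAddTorus (Fin 3) → EuclideanSpace ℝ (Fin 3)} (hv : Continuous v) {i j : Fin 3}
    {c : ℝ} (h : ∀ᵐ y ∂volume, v (A y) i = c * v y j) (y : UnitAddTorus (Fin 3)) :
    v (A y) i = c * v y j := by
  have h1 : Continuous fun y => v (A y) i :=
    (EuclideanSpace.proj i : EuclideanSpace ℝ (Fin 3) →L[ℝ] ℝ).continuous.comp (hv.comp hA)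
  have h2 : Continuous fun y => c * v y j :=
    continuous_const.mul
      ((EuclideanSpace.proj j : EuclideanSpace ℝ (Fin 3) →L[ℝ] ℝ).continuous.comp hv)
  exact congrFun ((Continuous.ae_eq_iff_eq volume h1 h2).1 h) y

end StubSymmSteadyState

open GPMeanBoundedFamily.StubSymmetricLimit StubSymmSteadyState in
/-- **S2 `stub_symmSteadyStateGP`** — from the symmetric Galerkin approximations (S1, taken as
hypothesis verbatim) to a `G`-symmetric mean-zero CLASSICAL steady state of `NS_ν(f_GP)` at every
`ν > 0`: a subsequence converges strongly in `L²` to a steady weak solution `u ∈ V` (compact enstrophy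
ball, `tendsto_integral_weakForm_of_tendsto_lintegral`, `tendsto_integral_weakForm_fourierTruncate`, as
in `exists_mem_energySpaceV_isSteadyWeakSolution`), the limit is `G`-symmetric a.e.
(`StubSymmetricLimit.ae_symm_of_tendsto`), Temam regularity gives a smooth representative
(`Temam1979_steadyWeakSolution_smooth_holds`) which is `G`-symmetric everywhere (two continuous fields
equal a.e. are equal), and the pressure is recovered from the smooth residual
(`DriftClassical.exists_pressure`); constant-in-time data are classical solutions on `univ × T³`
(`isSmoothSpaceTimeOn_const`, `timeDerivWithin univ (const) = 0`).
[cite: Temam1979, Ch. II Thm 1.2, Prop 1.1] -/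
theorem stub_symmSteadyStateGP :
    (∀ ν : ℝ, 0 < ν → ∀ N : ℕ, ∃ U : UnitAddTorus (Fin 3) → EuclideanSpace ℝ (Fin 3),
      Torus.IsSmooth U ∧ Torus.IsDivFree U ∧ Torus.HasZeroMean U ∧ IsGPSymmetric U ∧
      (∀ k ∉ (Torus.freqBall (d := Fin 3) N).erase 0,
        mFourierCoeff (EuclideanSpace.complexify ∘ U) k = 0) ∧
      Torus.eGradNormSq U ≤ ENNReal.ofReal (4 * Real.pi ^ 2 *
        ((∫ x, ‖gpForce x‖ ^ 2) / (4 * Real.pi ^ 2 * ν) ^ 2)) ∧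
      (∫⁻ x, ‖U x‖ₑ ^ 2 ≤ ENNReal.ofReal ((∫ x, ‖gpForce x‖ ^ 2) / (4 * Real.pi ^ 2 * ν) ^ 2)) ∧
      ∀ a : UnitAddTorus (Fin 3) → EuclideanSpace ℝ (Fin 3), Torus.IsSmooth a → Torus.IsDivFree a →
        (∀ k ∉ (Torus.freqBall (d := Fin 3) N).erase 0,
          mFourierCoeff (EuclideanSpace.complexify ∘ a) k = 0) →
        ∫ x, (⟪U x, Torus.convect U a x⟫_ℝ + ν * ⟪U x, Torus.laplacian a x⟫_ℝ + ⟪gpForce x, a x⟫_ℝ) = 0) →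
    ∀ ν : ℝ, 0 < ν → ∃ (u : UnitAddTorus (Fin 3) → EuclideanSpace ℝ (Fin 3)) (p : UnitAddTorus (Fin 3) → ℝ),
      Torus.IsClassicalNSSolutionOn Set.univ ν (fun _ => gpForce) (fun _ => u) (fun _ => p) ∧
      Torus.HasZeroMean u ∧ IsGPSymmetric u := by
  intro hGal ν hν
  choose U hUs hUdiv hUmean hUsym _hUband hUgrad hUL2 hUtest using hGal ν hν
  -- the force
  have hfs : Torus.IsSmooth gpForce := SteadyStatesLoudBounded.GpAdmissible.stub_gpAdmissible.1
  have hf0 : Torus.HasZeroMean gpForce :=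
    SteadyStatesLoudBounded.GpAdmissible.stub_gpAdmissible.2.2
  have hf2 : MemLp gpForce 2 volume := hfs.memLp 2
  -- (1) the limit `u ∈ V`: a steady weak solution, weak `L²` limit of a subsequence
  obtain ⟨u, φ, -, hV, hu, hweak⟩ := exists_limit hf2 ENNReal.ofReal_ne_top
    ENNReal.ofReal_ne_top hUs hUdiv hUmean hUgrad hUL2 hUtest
  have hUm : ∀ n, MemLp (U (φ n)) 2 volume := fun n => (hUs (φ n)).memLp 2
  have huL2 : MemLp (u.1 : UnitAddTorus (Fin 3) → EuclideanSpace ℝ (Fin 3)) 2 volume :=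
    Lp.memLp _
  -- (2) the limit is `G`-covariant a.e. (generatorwise, componentwise)
  set sg : Fin 3 → ℝ := ![1, -1, -1] with hsg
  have bc : ∀ i, ∀ᵐ y ∂volume,
      (u.1 : UnitAddTorus (Fin 3) → EuclideanSpace ℝ (Fin 3)) (cycShift y) i =
        1 * (u.1 : UnitAddTorus (Fin 3) → EuclideanSpace ℝ (Fin 3)) y (i + 1) := fun i =>
    ae_symm_of_tendsto measurePreserving_cycShift
      (measurePreserving_cycShift.comp measurePreserving_cycShift) cycShift_three hUm huL2 hweak
      fun n y => by rw [one_mul]; exact (hUsym (φ n)).1 y i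
  have bι : ∀ i, ∀ᵐ y ∂volume,
      (u.1 : UnitAddTorus (Fin 3) → EuclideanSpace ℝ (Fin 3)) (-y) i =
        -1 * (u.1 : UnitAddTorus (Fin 3) → EuclideanSpace ℝ (Fin 3)) y i := fun i =>
    ae_symm_of_tendsto measurePreserving_neg_torus measurePreserving_neg_torus neg_neg hUm huL2
      hweak fun n y => by rw [neg_one_mul]; exact (hUsym (φ n)).2.1 y i
  have bτ : ∀ i, ∀ᵐ y ∂volume,
      (u.1 : UnitAddTorus (Fin 3) → EuclideanSpace ℝ (Fin 3)) (twistTurn y) i =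
        sg i * (u.1 : UnitAddTorus (Fin 3) → EuclideanSpace ℝ (Fin 3)) y i := fun i =>
    ae_symm_of_tendsto measurePreserving_twistTurn measurePreserving_twistTurn twistTurn_twistTurn
      hUm huL2 hweak fun n y => (twist_clause_iff _ _).1 ((hUsym (φ n)).2.2 y) i
  -- (3) Temam regularity: a smooth representative, `G`-symmetric at every point
  obtain ⟨v, hv, hae⟩ :=
    Torus.Temam1979_steadyWeakSolution_smooth_holds (d := Fin 3) (by simp) hν hfs hV hu
  have hvc : Continuous v := hv.continuous
  have hsym : IsGPSymmetric v := by
    refine ⟨fun y i => ?_, fun y i => ?_, fun y => (twist_clause_iff _ _).2 fun i => ?_⟩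
    · have h := symm_of_ae continuous_cycShift hvc
        (ae_transport measurePreserving_cycShift hae.symm (fun a b => a i = 1 * b (i + 1)) (bc i)) y
      rwa [one_mul] at h
    · rw [symm_of_ae continuous_neg hvc
        (ae_transport measurePreserving_neg_torus hae.symm (fun a b => a i = -1 * b i) (bι i)) y,
        neg_one_mul]
    · exact symm_of_ae continuous_twistTurn hvc
        (ae_transport measurePreserving_twistTurn hae.symm (fun a b => a i = sg i * b i) (bτ i)) y
  -- (4) the pressure, and the packaging as a classical solution on `univ × T³`
  obtain ⟨p, hp, hdiv, hv0, hmom⟩ :=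
    RobustLoudUpgrade.Category.DriftClassical.exists_pressure hfs hf0 hu hv hae
  refine ⟨v, p, ⟨Torus.isSmoothSpaceTimeOn_const hv _, Torus.isSmoothSpaceTimeOn_const hp _,
    fun t _ x => ?_, fun _ _ => hdiv⟩, hv0, hsym⟩
  have h0 : Torus.timeDerivWithin Set.univ (fun _ : ℝ => v) t x = 0 := by
    simp [Torus.timeDerivWithin]
  rw [h0, zero_add]
  exact hmom x

end Summit.AnomalousDissipation.AnomalousDissipation.Theorems.VirtualDissipation.LightSteadyStatesGP

end
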